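import Mathlib.Analysis.Calculus.Deriv.MeanValue
import Mathlib.Topology.Order.Compact
import Literature.NumberTheory.LFunctions.WeilThetaPhiMellin
import Literature.NumberTheory.LFunctions.DeBruijnPhiDecreasing
import HarnessLib

/-!
# The origin regime of Riemann's kernel: decay of `Φ″`, linear floor for `−Φ′` on `[0, 1]`
(crux OddBartaFloor, line Sketch, stub phiOrigin)

Two elementary facts about the Rodgers–Tao-normalised Pólya–de Bruijn kernel `Φ_RT = deBruijnPhi`
and the derivative `Φ′ = weilThetaPhiDeriv` (`weilThetaPhiDeriv t = deBruijnPhiDeriv (t/2)`) of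
Riemann's kernel in Weil's additive variable:

* `|Φ_RT″(u)| = |deBruijnPhiDeriv₂ u| ≤ C e^{−4u}` for `u ≥ 0`. From the one-series form
  `deBruijnPhiDeriv₂_eq_tsum` (`Φ_RT″(u) = eᵘ ∑_n q(y_n) e^{−y_n}`, `q(y) = −75y + 330y² − 224y³ + 32y⁴`,
  `y_n = π(n+1)²x`, `x = e^{4u} ≥ 1`): termwise `|q(y)|e^{−y} ≤ 661 y⁴e^{−y} ≤ 661·384 e^{−y/2}`
  and `e^{−y_n/2} ≤ ρ^{n+1}`, `ρ = e^{−πx/2} ≤ 1/2`, so `|Φ_RT″(u)| ≤ 2·661·384 e^{u − (π/2)e^{4u}}`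
  (the pattern of the tree's `abs_deBruijnPhiDeriv_le`), and `u − (π/2)e^{4u} ≤ −4u`.
* `∃ c > 0, c t ≤ −Φ′(t)` on `[0, 1]`. On `[0, 1/96]` the tree's `deBruijnPhiDeriv₂_neg` and the
  extreme value theorem give `Φ_RT″ ≤ −c₁ < 0`, so `Φ_RT′(u) ≤ −c₁u` there (mean value inequality,
  `Φ_RT′(0) = 0`), i.e. `−Φ′(t) ≥ (c₁/2)t` on `[0, 1/48]`; on `[1/48, 1]` the continuous positive
  function `−Φ′` (`weilThetaPhiDeriv_neg_of_pos`) has a positive minimum `c₂ ≥ c₂ t`.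

Elementary; no published source needed. [folklore]
-/

set_option linter.dupNamespace false

noncomputable section

open Set MeasureTheory Filter Complex
open scoped Real Topology ComplexConjugate ArithmeticFunction.vonMangoldt ENNReal

namespace Summit.RiemannHypothesis.RiemannHypothesis.Theorems.OddBartaFloor

open Literature.NumberTheory.LFunctions

/-! ## Part (i): super-exponential decay of `Φ_RT″` -/

/-- `y⁴ e^{−y} ≤ 384 e^{−y/2}` for `y ≥ 0` (`(y/2)⁴/4! ≤ e^{y/2}`). [folklore] -/
private theorem stub_phiOrigin_pow_four_le {y : ℝ} (hy : 0 ≤ y) :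
    y ^ 4 * rexp (-y) ≤ 384 * rexp (-y / 2) := by
  have h := Real.pow_div_factorial_le_exp (y / 2) (by linarith) 4
  have h24 : (Nat.factorial 4 : ℝ) = 24 := by norm_num [Nat.factorial]
  rw [h24, div_le_iff₀ (by norm_num)] at h
  have e : (y / 2) ^ 4 = y ^ 4 / 16 := by ring
  rw [e] at h
  have h' : y ^ 4 ≤ 384 * rexp (y / 2) := by linarith
  calc y ^ 4 * rexp (-y) ≤ 384 * rexp (y / 2) * rexp (-y) := by gcongr
    _ = 384 * rexp (-y / 2) := by
        rw [mul_assoc, ← Real.exp_add]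
        congr 2
        ring

/-- Termwise bound for the series of `Φ_RT″` (`deBruijnPhiDeriv₂_eq_tsum`): for `x ≥ 1`, with
`ρ = e^{−πx/2}`, `|q(y_n) e^{−y_n}| ≤ 661 y_n⁴ e^{−y_n} ≤ 253824 e^{−y_n/2} ≤ 253824 ρ^{n+1}`.
[folklore] -/
private theorem stub_phiOrigin_term_le {x : ℝ} (hx : 1 ≤ x) (n : ℕ) :
    |phiPolyTerm (-75) 330 (-224) 32 x n| ≤
      253824 * (rexp (-(π * x / 2)) * rexp (-(π * x / 2)) ^ n) := by
  have hπ := Real.pi_gt_three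
  set y := thetaFreq x n with hydef
  have hyx : π * x ≤ y := pi_mul_le_thetaFreq (zero_le_one.trans hx) n
  have hy1 : 1 ≤ y := by nlinarith
  have hy0 : 0 ≤ y := zero_le_one.trans hy1
  -- the polynomial factor
  have hpoly : |-75 * y + 330 * y ^ 2 + -224 * y ^ 3 + 32 * y ^ 4| ≤ 661 * y ^ 4 := by
    have h1 : y ^ 1 ≤ y ^ 4 := pow_le_pow_right₀ hy1 (by norm_num)
    have h2 : y ^ 2 ≤ y ^ 4 := pow_le_pow_right₀ hy1 (by norm_num)
    have h3 : y ^ 3 ≤ y ^ 4 := pow_le_pow_right₀ hy1 (by norm_num)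
    rw [pow_one] at h1
    rw [abs_le]
    constructor <;> nlinarith [pow_nonneg hy0 2, pow_nonneg hy0 3, pow_nonneg hy0 4]
  -- the geometric factor: `e^{−y/2} ≤ ρ^{n+1}` since `y ≥ πx(n+1)`
  have hgeom : rexp (-y / 2) ≤ rexp (-(π * x / 2)) * rexp (-(π * x / 2)) ^ n := by
    rw [← pow_succ', ← Real.exp_nat_mul]
    apply Real.exp_le_exp.2
    have hn : (0 : ℝ) ≤ n := n.cast_nonneg
    have h : π * x * ((n : ℝ) + 1) ≤ y := by
      rw [hydef, thetaFreq]
      have : (n : ℝ) + 1 ≤ ((n : ℝ) + 1) ^ 2 := by nlinarith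
      nlinarith [Real.pi_pos, mul_nonneg Real.pi_pos.le (zero_le_one.trans hx)]
    push_cast
    linarith
  calc |phiPolyTerm (-75) 330 (-224) 32 x n|
      = |-75 * y + 330 * y ^ 2 + -224 * y ^ 3 + 32 * y ^ 4| * rexp (-y) := by
        rw [phiPolyTerm, abs_mul, abs_of_pos (Real.exp_pos _)]
    _ ≤ 661 * y ^ 4 * rexp (-y) := by gcongr
    _ = 661 * (y ^ 4 * rexp (-y)) := by ring
    _ ≤ 661 * (384 * rexp (-y / 2)) :=
        mul_le_mul_of_nonneg_left (stub_phiOrigin_pow_four_le hy0) (by norm_num)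
    _ = 253824 * rexp (-y / 2) := by ring
    _ ≤ 253824 * (rexp (-(π * x / 2)) * rexp (-(π * x / 2)) ^ n) := by gcongr

/-- **Super-exponential decay of `Φ_RT″`**: `|deBruijnPhiDeriv₂ u| ≤ 507648 exp(u − (π/2)e^{4u})` for
`u ≥ 0` (from the one-series form and `∑_n ρ^{n+1} ≤ 2ρ`, `ρ = e^{−πx/2} ≤ 1/2`). [folklore] -/
theorem stub_phiOrigin_abs_deBruijnPhiDeriv₂_le {u : ℝ} (hu : 0 ≤ u) :
    |deBruijnPhiDeriv₂ u| ≤ 507648 * rexp (u - π / 2 * rexp (4 * u)) := by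
  have hπ := Real.pi_gt_three
  have hx1 : 1 ≤ rexp (4 * u) := Real.one_le_exp (by linarith)
  set x := rexp (4 * u) with hxdef
  set ρ := rexp (-(π * x / 2)) with hρ
  have hρ0 : 0 ≤ ρ := (Real.exp_pos _).le
  have hρhalf : ρ ≤ 1 / 2 := by
    have h2 : 2 ≤ rexp (π * x / 2) := by
      have := Real.add_one_le_exp (π * x / 2)
      nlinarith
    have hpos := Real.exp_pos (π * x / 2)
    rw [hρ, Real.exp_neg, inv_eq_one_div, div_le_div_iff₀ hpos two_pos]
    linarith
  have hρ1 : ρ < 1 := by linarith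
  have hsum : HasSum (fun n : ℕ => 253824 * (ρ * ρ ^ n)) (253824 * (ρ * (1 - ρ)⁻¹)) :=
    ((hasSum_geometric_of_lt_one hρ0 hρ1).mul_left ρ).mul_left 253824
  have hbound : ‖∑' n, phiPolyTerm (-75) 330 (-224) 32 x n‖ ≤ 253824 * (ρ * (1 - ρ)⁻¹) :=
    tsum_of_norm_bounded hsum fun n => by
      rw [Real.norm_eq_abs]; exact stub_phiOrigin_term_le hx1 n
  have hgeo : ρ * (1 - ρ)⁻¹ ≤ 2 * ρ := by
    rw [← div_eq_mul_inv, div_le_iff₀ (by linarith)]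
    nlinarith
  rw [Real.norm_eq_abs] at hbound
  rw [deBruijnPhiDeriv₂_eq_tsum, abs_mul, abs_of_pos (Real.exp_pos u), ← hxdef]
  calc rexp u * |∑' n, phiPolyTerm (-75) 330 (-224) 32 x n| ≤ rexp u * (253824 * (2 * ρ)) := by
        refine mul_le_mul_of_nonneg_left (hbound.trans ?_) (Real.exp_pos u).le
        exact mul_le_mul_of_nonneg_left hgeo (by norm_num)
    _ = 507648 * (rexp u * ρ) := by ring
    _ = 507648 * rexp (u - π / 2 * x) := by
        rw [hρ, ← Real.exp_add]
        congr 2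
        ring

/-- **Part (i)**: `|Φ_RT″(u)| ≤ 507648 e^{−4u}` for `u ≥ 0` (`u − (π/2)e^{4u} ≤ −4u` because
`e^{4u} ≥ 1 + 4u` and `π > 3`). [folklore] -/
theorem stub_phiOrigin_decay :
    ∃ C : ℝ, ∀ u : ℝ, 0 ≤ u → |deBruijnPhiDeriv₂ u| ≤ C * rexp (-4 * u) := by
  refine ⟨507648, fun u hu => (stub_phiOrigin_abs_deBruijnPhiDeriv₂_le hu).trans ?_⟩
  refine mul_le_mul_of_nonneg_left (Real.exp_le_exp.2 ?_) (by norm_num)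
  have h1 : 1 + 4 * u ≤ rexp (4 * u) := by
    have := Real.add_one_le_exp (4 * u)
    linarith
  have h2 := mul_le_mul_of_nonneg_left h1 (by positivity : (0 : ℝ) ≤ π / 2)
  nlinarith [mul_nonneg (by linarith [Real.pi_gt_three] : (0 : ℝ) ≤ 2 * π - 5) hu, Real.pi_pos]

/-! ## Part (ii): the linear floor `−Φ′(t) ≥ c t` on `[0, 1]` -/

/-- `Φ_RT″ = deBruijnPhiDeriv₂` is continuous. [folklore] -/
private theorem stub_phiOrigin_continuous_deriv₂ : Continuous deBruijnPhiDeriv₂ := by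
  unfold deBruijnPhiDeriv₂; fun_prop

/-- Uniform negativity of `Φ_RT″` near `0`: there is `c₁ > 0` with `Φ_RT″(u) ≤ −c₁` on `[0, 1/96]`
(`deBruijnPhiDeriv₂_neg` and the extreme value theorem). [folklore] -/
private theorem stub_phiOrigin_exists_deriv₂_le :
    ∃ c₁ : ℝ, 0 < c₁ ∧ ∀ u ∈ Icc (0 : ℝ) (1 / 96), deBruijnPhiDeriv₂ u ≤ -c₁ := by
  obtain ⟨u₀, hu₀, hmax⟩ := (isCompact_Icc (a := (0 : ℝ)) (b := 1 / 96)).exists_isMaxOn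
    (nonempty_Icc.2 (by norm_num)) stub_phiOrigin_continuous_deriv₂.continuousOn
  refine ⟨-deBruijnPhiDeriv₂ u₀, neg_pos.2 (deBruijnPhiDeriv₂_neg hu₀.1 hu₀.2), fun u hu => ?_⟩
  rw [neg_neg]
  exact isMaxOn_iff.1 hmax u hu

/-- The floor near the origin for `Φ_RT′`: if `Φ_RT″ ≤ −c₁` on `[0, 1/96]` then `Φ_RT′(u) ≤ −c₁ u`
there (mean value inequality from `Φ_RT′(0) = 0`). [folklore] -/
private theorem stub_phiOrigin_deBruijnPhiDeriv_le {c₁ : ℝ}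
    (hc : ∀ u ∈ Icc (0 : ℝ) (1 / 96), deBruijnPhiDeriv₂ u ≤ -c₁) {u : ℝ}
    (hu : u ∈ Icc (0 : ℝ) (1 / 96)) : deBruijnPhiDeriv u ≤ -c₁ * u := by
  have h := (convex_Icc (0 : ℝ) (1 / 96)).image_sub_le_mul_sub_of_deriv_le
    continuous_deBruijnPhiDeriv.continuousOn
    (fun x _ => (hasDerivAt_deBruijnPhiDeriv x).differentiableAt.differentiableWithinAt)
    (fun x hx => by
      rw [deriv_deBruijnPhiDeriv]
      exact hc x (interior_subset hx))
    0 (left_mem_Icc.2 (by norm_num)) u hu hu.1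
  rwa [deBruijnPhiDeriv_zero, sub_zero, sub_zero] at h

/-- **Part (ii)**: there is `c > 0` with `c t ≤ −Φ′(t)` for `t ∈ [0, 1]` (`(c₁/2) t` on `[0, 1/48]`
by the origin floor, the positive minimum of `−Φ′` on `[1/48, 1]` beyond). [folklore] -/
theorem stub_phiOrigin_floor :
    ∃ c : ℝ, 0 < c ∧ ∀ t ∈ Icc (0 : ℝ) 1, c * t ≤ -weilThetaPhiDeriv t := by
  obtain ⟨c₁, hc₁, hc⟩ := stub_phiOrigin_exists_deriv₂_le
  obtain ⟨t₀, ht₀, hmin⟩ := (isCompact_Icc (a := (1 / 48 : ℝ)) (b := 1)).exists_isMinOn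
    (nonempty_Icc.2 (by norm_num)) continuous_weilThetaPhiDeriv.neg.continuousOn
  have hc₂ : 0 < -weilThetaPhiDeriv t₀ :=
    neg_pos.2 (weilThetaPhiDeriv_neg_of_pos (by linarith [ht₀.1]))
  refine ⟨min (c₁ / 2) (-weilThetaPhiDeriv t₀), lt_min (half_pos hc₁) hc₂, fun t ht => ?_⟩
  rcases le_or_gt t (1 / 48) with h | h
  · have hu : t / 2 ∈ Icc (0 : ℝ) (1 / 96) := ⟨by linarith [ht.1], by linarith⟩
    have h1 := stub_phiOrigin_deBruijnPhiDeriv_le hc hu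
    have h2 : min (c₁ / 2) (-weilThetaPhiDeriv t₀) * t ≤ c₁ / 2 * t :=
      mul_le_mul_of_nonneg_right (min_le_left _ _) ht.1
    have e : weilThetaPhiDeriv t = deBruijnPhiDeriv (t / 2) := rfl
    linarith
  · have h1 : -weilThetaPhiDeriv t₀ ≤ -weilThetaPhiDeriv t := isMinOn_iff.1 hmin t ⟨h.le, ht.2⟩
    have h2 : min (c₁ / 2) (-weilThetaPhiDeriv t₀) * t ≤ -weilThetaPhiDeriv t₀ * t :=
      mul_le_mul_of_nonneg_right (min_le_right _ _) ht.1
    have h3 : -weilThetaPhiDeriv t₀ * t ≤ -weilThetaPhiDeriv t₀ :=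
      mul_le_of_le_one_right hc₂.le ht.2
    linarith

/-- **The origin regime of the floor estimate** (crux OddBartaFloor, line Sketch): (i) a decaying
bound `|Φ_RT″(u)| ≤ C e^{−4u}` (`u ≥ 0`) for the second derivative `deBruijnPhiDeriv₂` of the
Pólya–de Bruijn kernel, and (ii) a linear lower bound `−Φ′(t) ≥ c t` on `[0, 1]` for Riemann's kernel
`Φ′ = weilThetaPhiDeriv`. [folklore] -/
theorem stub_phiOrigin :
    (∃ C : ℝ, ∀ u : ℝ, 0 ≤ u → |deBruijnPhiDeriv₂ u| ≤ C * rexp (-4 * u)) ∧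
    (∃ c : ℝ, 0 < c ∧ ∀ t ∈ Icc (0 : ℝ) 1, c * t ≤ -weilThetaPhiDeriv t) :=
  ⟨stub_phiOrigin_decay, stub_phiOrigin_floor⟩

end Summit.RiemannHypothesis.RiemannHypothesis.Theorems.OddBartaFloor

end
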